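import Mathlib
import Summits.KontsevichZagierPeriods.Zeta5Search.WedgeDictionary
import Summits.KontsevichZagierPeriods.Zeta5Search.XSaveRhoValuation
import HarnessLib

/-!
# XSAVE conjectures v3 (cell `pub-zeta5`, census seats g6 → g7) — typed skeleton for p1 / typer, NOT literature

HONEST FRAMING: systematic search; no irrationality claim unless certified.

Provenance: written by the census seats g6/g7 (planner role, no stage permission; staged `code/census/g7/lean/XSaveConjectures.lean` v3),
filed verbatim by typer g6 with one addition: `rhoVal_beyondM1` is no longer open — it is PROVED (`rhoVal_beyondM1_holds`, from
`XSave.padicValRat_rhoOf` in `XSaveRhoValuation.lean`).  Every other `@[conjecture]` below is an INTERNALLY MINTED, OBSERVED statement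
(exact finite evidence only) — never a fact.

These are the census's D(a)-laws (STRUCTURE.md §10.4 / §11, conjectures W-XS1 / W-XS2 with exact finite evidence),
typed over the EXISTING vocabulary of `WedgeDictionary.lean` (`rhoOf`, `coeffU/W/V`, `dOf`, `bOfA`) — i.e. they are
statements about the DICTIONARY numerators `P̂ = ρ(UV′ − U′V)`, `P = ρ(W′V − WV′)` (internally minted objects; under
the conjecture `wedgeDictionary` these are the `ζ(3)`/`ζ(5)`-companions of the Brown–Zudilin linear forms).
Nothing here is cited; apart from `rhoVal_beyondM1` (proved) every `def … : Prop` is a TARGET.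

v3 (census g7, 2026-08-20) — TWO CORRECTIONS to v1 (`code/census/g6/lean/XSaveConjectures.lean`); v2 (same
day, same seat) had only the second one and is withdrawn.
(A) MISSING HYPOTHESIS `m₁(n·a) < p`.  The census LAWS always read 'no prime beyond max(m₁n, Dn)' (side `P̂`) and
'no prime beyond max(m₁n, Dn/2)' (side `P`) — primes `p ≤ m₁n` lie in BZ's `d_{m₁n}` and divide the denominators
routinely — but v1 typed `XS1_noPrimeBeyondD` / `XS2_noPrimeBeyondHalfD` WITHOUT `m1Of (n • a) < p`, i.e. as
'no prime beyond Dn' / 'beyond Dn/2'.  As typed they are false wholesale on the regular cone: 5 195 resp. 38 061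
violating (pair, prime) among the census rows; smallest witnesses: the RECORD `a = (8,16,10,15,12,16,18,13)`, `n = 1`
(`m₁ = 18`, `D = 25`): `v₁₃(P) = −4`, `v₁₇(P) = −1` although `2·13 > 25`; and `a = (15,38,17,37,19,23,25,20)`, `n = 1`
(`m₁ = 39`, `D = 24`): `v₂₉(P̂) = v₃₁(P̂) = −3` although `29 > 24`.  v3 adds `m1Of (n • a) < p →` to both.
(B) THE TWO SYMMETRIC CORNERS.  With (A) in place the only exceptions in the whole census (≥ 10 422 exact pairs
`(a,n)`, ≥ 1 119 directions = 1 064 classes modulo permutations of `b₁,…,b₇`, `n ≤ 40`, kit jobs tagged `exact`, ids in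
STRUCTURE §10–§11 / EFFICIENCY.md) are at the totally symmetric direction `a = 1⁸`, the only direction with
`m₁(n·a) ≤ 2` for some `n`: (i) `n = 1`, `p = 2`: `b = (3;1⁷)`, `m₁ = 1`, `d = 2`, den `P(1⁸)` = den `P̂(1⁸)` = `2²`
(`P₁ = 87/4`, `P̂₁ = 101/4`), so `v₂ = −2` violates both window statements and `XS2_noPrimeBeyondHalfD`;
(ii) `n = 2`, `p = 3`: `b = (6;2⁷)`, `m₁ = 2`, `d = 4`, `P₂ = 1190161/384 = 1190161/(2⁷·3)`, so `v₃(P(2⁸)) = −1`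
although `3 > m₁·2` and `2·3 > d` — violates `XS2_noPrimeBeyondHalfD` only (`P̂₂ = 344923/96`, `v₃ = −1 ≥ −1`, inside
its window `(2, 4]`).  All four values are PRINTED (Brown–Zudilin Sect. 2; tree
`Literature.NumberTheory.Irrationality.BrownZudilin2022.TotallySymmetric.P / .Phat` initial data; Zudilin 2002) and
reproduced by the census kernel — two implementations.  v3 therefore carries `p ≠ 2` on the two window-exponent
statements, `3 < p` on `XS2_noPrimeBeyondHalfD` (for `p ∈ {2,3}` to exceed `m₁(n·a)` one needs `m₁(n·a) ≤ 2`, i.e.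
exactly the corners), nothing on `XS1_noPrimeBeyondD` (0 exceptions even for `p = 2, 3`), and records the corners as
the decidable instances `cornerTwo`, `cornerThree`.  With these hypotheses: 0 exceptions.

SYMMETRY NOTE (census g7).  The model quantities of a direction (the 28-form multiset, `m₁`, `D = d(b)`, the cell
structure of the arithmetic saving) depend only on `b₀` and the MULTISET `{b₁,…,b₇}`; `rhoOf` is not invariant under
permuting `b₁…b₇` (its factorials single out `b₁,b₄,b₅,b₆,b₇` and the 15 pairs `E`), so `P̂`, `P` of two directions
with permuted dual data differ by small-prime units only (observed: identical large-prime valuations, bit sizes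
within ±1).  Coverage counts in the census are therefore stated modulo this `S₇` action.
-/

noncomputable section

open Finset

namespace Summit.KontsevichZagierPeriods.Zeta5Search.XSave

open Summit.KontsevichZagierPeriods.Zeta5Search.WedgeDictionary (rhoOf coeffU coeffW coeffV dOf Epairs)
open Literature.NumberTheory.Irrationality.BrownZudilin2022 (bOfA hList Converges QOf)

/-- The dictionary `ζ(3)`-numerator with partner `j`: `P̂(a) = ρ(a)·(U(b)V(b′) − U(b′)V(b))`, `b = b(a)`, `b′ = b + e_j`. -/
def PhatOf (a : Fin 8 → ℤ) (j : ℕ) : ℚ :=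
  let b := bOfA a
  let b' := Function.update b j (b j + 1)
  rhoOf a * (coeffU b * coeffV b' - coeffU b' * coeffV b)

/-- The dictionary `ζ(5)`-numerator with partner `j`: `P(a) = ρ(a)·(W(b′)V(b) − W(b)V(b′))`. -/
def POf (a : Fin 8 → ℤ) (j : ℕ) : ℚ :=
  let b := bOfA a
  let b' := Function.update b j (b j + 1)
  rhoOf a * (coeffW b' * coeffV b - coeffW b * coeffV b')

/-- The region of the dictionary conjecture (`wedgeDictionary`) at `a` with partner `j`. -/
def InRegion (a : Fin 8 → ℤ) (j : ℕ) : Prop :=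
  j ∈ Icc 1 7 ∧ Converges a ∧ (∀ i ∈ Icc 1 7, 0 ≤ bOfA a i ∧ 2 * bOfA a i ≤ bOfA a 0 + 1) ∧
    0 ≤ dOf (bOfA a) ∧ 2 * (bOfA a j + 1) ≤ bOfA a 0 + 1

/-- `m₁(a)` = the largest of the 28 forms `h_i(a)`. -/
def m1Of (a : Fin 8 → ℤ) : ℤ := (hList a).foldr max 0

/-- **ρ-valuation beyond m₁ (NOT an open problem: PROVABLE from the definition of `rhoOf` by Legendre's formula;
PROVED in the tree: `rhoVal_beyondM1_holds`).**  For a prime `p ≠ 2` exceeding every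
factorial argument of `rhoOf` other than `d` — the 15 numbers `b₀−b_j−b_k`, `(j,k) ∈ E`, and `b₁,b₄,b₅,b₆,b₇` (all of
them among the 28 forms `h_i(a)`, so `p > m₁(a)` suffices) — one has `v_p(ρ(a)) = −v_p(d(b(a))!)`.  This is the
mechanism behind the D-laws: beyond `m₁n` the `p`-part of den `P̂(na)`, den `P(na)` is `p^{v_p((Dn)!)}` divided by
the `p`-part of a 2×2 minor of the dual coefficient vectors (census: that minor has valuation exactly
`v_p((Dn)!) − 1` on the windows of XS-1/XS-2 and ≥ `v_p((Dn)!)` beyond them). -/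
def rhoVal_beyondM1 : Prop :=
  ∀ (a : Fin 8 → ℤ) (p : ℕ), p.Prime → p ≠ 2 →
    (∀ jk ∈ Epairs, (bOfA a 0 - bOfA a jk.1 - bOfA a jk.2).toNat < p) →
    (∀ j ∈ ([1, 4, 5, 6, 7] : List ℕ), (bOfA a j).toNat < p) →
    padicValRat p (rhoOf a) = -((padicValNat p (dOf (bOfA a)).toNat.factorial : ℕ) : ℤ)

/-- `rhoVal_beyondM1` is a THEOREM (typer g6, `XSave.padicValRat_rhoOf`). -/
theorem rhoVal_beyondM1_holds : rhoVal_beyondM1 := fun a p hp hp2 hE hJ => padicValRat_rhoOf a p hp hp2 hE hJ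

/-- **W-XS1 (upper half; v3: with `m₁(na) < p`; 0 exceptions, any prime).**  No prime beyond
`max(m₁(na), d(b(na)))` divides the denominator of the `ζ(3)`-numerator: `p > m₁(na) ∧ p > d(b(na)) ⟹ v_p(P̂(na)) ≥ 0`
(v1/v2 omitted `m₁(na) < p` and are false at `a = (15,38,17,37,19,23,25,20)`, `n = 1`, `p = 29`). -/
@[conjecture] def XS1_noPrimeBeyondD : Prop :=
  ∀ (a : Fin 8 → ℤ) (j n p : ℕ), 1 ≤ n → InRegion (n • a) j → p.Prime →
    m1Of (n • a) < p → dOf (bOfA (n • a)) < p → 0 ≤ padicValRat p (PhatOf (n • a) j)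

/-- **W-XS1 (window half, one-sided; since v2: `p ≠ 2`).**  Every ODD prime in `(m₁(na), d(b(na))]` divides den `P̂(na)`
at most once: `v_p(P̂(na)) ≥ −1` (generically `= −1`; equality fails on a sporadic set, so only the inequality is
conjectured).  v1 (without `p ≠ 2`) is false at `(1⁸, n = 1, p = 2)`: `v₂(P̂(1⁸)) = −2` (`cornerTwo`). -/
@[conjecture] def XS1_windowExponentLeOne : Prop :=
  ∀ (a : Fin 8 → ℤ) (j n p : ℕ), 1 ≤ n → InRegion (n • a) j → p.Prime → p ≠ 2 →
    m1Of (n • a) < p → -1 ≤ padicValRat p (PhatOf (n • a) j)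

/-- **W-XS2 (upper half; v3: with `m₁(na) < p` and `p > 3`; 0 exceptions).**  No prime beyond
`max(m₁(na), d(b(na))/2)` divides the denominator of the `ζ(5)`-numerator: `p > m₁(na) ∧ 2p > d(b(na)) ⟹ v_p(P(na)) ≥ 0`
(v1/v2 omitted `m₁(na) < p` and are false at the record, `n = 1`, `p = 13`: `v₁₃(P) = −4`; `p > 3` excludes the
symmetric corner `(1⁸, n = 2, p = 3)`, `cornerThree`).  COROLLARY: Brown–Zudilin's inclusion (28)
(`d_{m₁n}⋯d_{m₅n} I′(a·n) ∈ ℤζ(5)+ℤ`) can only hold when `D(a) ≤ 2 m₁(a)`; the census exhibits its failure at every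
one of 244 sampled directions with `D > 2m₁` (witness `a = (42,5,44,4,46,50,52,47)`, `n = 1`: `53·59·61·67 ∣ den P`).
The corner `(1⁸, 1, 2)` (`d = 2 < 4`, `v₂(P(1⁸)) = −2`, `cornerTwo`) is excluded by `3 < p` as well. -/
@[conjecture] def XS2_noPrimeBeyondHalfD : Prop :=
  ∀ (a : Fin 8 → ℤ) (j n p : ℕ), 1 ≤ n → InRegion (n • a) j → p.Prime → 3 < p →
    m1Of (n • a) < p → dOf (bOfA (n • a)) < 2 * (p : ℤ) → 0 ≤ padicValRat p (POf (n • a) j)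

/-- **W-XS2 (window half, one-sided; since v2: `p ≠ 2`).**  ODD primes in `(m₁(na), d(b(na))/2]` divide den `P(na)` at
most once (v1 is false at `(1⁸, 1, 2)`: `v₂(P(1⁸)) = −2`, `cornerTwo`). -/
@[conjecture] def XS2_windowExponentLeOne : Prop :=
  ∀ (a : Fin 8 → ℤ) (j n p : ℕ), 1 ≤ n → InRegion (n • a) j → p.Prime → p ≠ 2 →
    m1Of (n • a) < p → -1 ≤ padicValRat p (POf (n • a) j)

/-- **¬(28) on the whole cone `D > 2m₁` (census g6+g7: in 244/244 sampled directions with `D(a) > 2m₁(a)` —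
on the consecutive-b plane and random off-plane ones incl. all tested with `D ∈ {2m₁+1, 2m₁+2}` — an ODD prime
`p > m₁n` divides den `P(na)` for some sampled `n` (g6: first failure at n = 1 in 66 of its 102, n = 2 in 22,
n = 3,4,5 in 6,7,1); in 873/874 sampled directions with `D ≤ 2m₁` none does, for every sampled n — the one exception
being the corner `a = 1⁸, n = 1, p = 2` (`cornerTwo`), where `d₁ = 1` and (28) is not at stake).**
If `D(a) > 2m₁(a)` then for some `n` some odd prime beyond `m₁n` divides the denominator of the `ζ(5)`-numerator — so
NO inclusion of the shape `d_{m₁n}^k · I′(a·n) ∈ ℤζ(5)+ℤ` (in particular BZ (28)) can hold for all `n` at such `a`.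
The threshold is sharp by `XS2_noPrimeBeyondHalfD`: for `D ≤ 2m₁` the window `(m₁n, Dn/2]` is empty. -/
@[conjecture] def XS2_failsBeyondTwiceM1 : Prop :=
  ∀ (a : Fin 8 → ℤ) (j : ℕ), (∀ n : ℕ, 1 ≤ n → InRegion (n • a) j) → 2 * m1Of a < dOf (bOfA a) →
    ∃ n p : ℕ, 1 ≤ n ∧ p.Prime ∧ p ≠ 2 ∧ m1Of (n • a) < p ∧ padicValRat p (POf (n • a) j) < 0

/-- **¬(28) at the witness (a DECIDABLE instance, handed to p1):** at `a = (42,5,44,4,46,50,52,47)` (all 28 `h ≥ 0`,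
`m₁ = 52`, `D = 138`, dual `b = (53; 6,5,4,3,2,1,0)`, partner `j = 7`) the prime `53 > m₁` divides den `P(a)`:
census value `v₅₃(P(a)) = −1` (likewise 59, 61, 67).  Exact rational arithmetic; a kernel proof needs an evaluator
for `coeffV` (harmonic-number sums), which the tree does not yet have — hence stated, not proved. -/
@[conjecture] def witness28 : Prop := padicValRat 53 (POf ![42, 5, 44, 4, 46, 50, 52, 47] 7) = -1

/-- **The corner `(1⁸, n = 1, p = 2)` (a DECIDABLE instance; census value, two implementations — the XSAVE kernel
(`code/census/g6/job_xsave/lib/rho.py`, den `P(1⁸) = den P̂(1⁸) = 4`) and Zudilin's closed form at the symmetric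
point (`87/4 = p₁/2` in the normalisation of `Zudilin2002.WellPoisedForms.values_one`)):** with partner `j = 1`,
`v₂(P(1⁸)) = −2` and `v₂(P̂(1⁸)) = −2`.  This refutes v1 of the two window statements and of `XS2_noPrimeBeyondHalfD`
(all typed without `p ≠ 2` in v1) and is the reason for the hypotheses `p ≠ 2` / `3 < p` since v2. -/
@[conjecture] def cornerTwo : Prop :=
  padicValRat 2 (POf ![1, 1, 1, 1, 1, 1, 1, 1] 1) = -2 ∧ padicValRat 2 (PhatOf ![1, 1, 1, 1, 1, 1, 1, 1] 1) = -2

/-- **The corner `(1⁸, n = 2, p = 3)` (a DECIDABLE instance; PRINTED value `P₂ = 1190161/384 = 1190161/(2⁷·3)`,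
Brown–Zudilin Sect. 2 = tree `Literature.NumberTheory.Irrationality.BrownZudilin2022.TotallySymmetric.P` initial
data, reproduced by the census kernel with partner `j = 1`):** `v₃(P(2⁸)) = −1` although `3 > m₁(2⁸) = 2` and
`2·3 > d(b(2⁸)) = 4` — the reason for `3 < p` in `XS2_noPrimeBeyondHalfD` v3.  (`P̂₂ = 344923/96`: `v₃ = −1`, inside
its window, consistent with `XS1_windowExponentLeOne`.) -/
@[conjecture] def cornerThree : Prop := padicValRat 3 (POf ![2, 2, 2, 2, 2, 2, 2, 2] 1) = -1

/-- Sanity: at the corner `b(1⁸) = (3; 1,1,1,1,1,1,1)`, `d = 2`, `m₁ = 1`, and `InRegion 1⁸ 1` holds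
(so v1's statements really are instantiated there). -/
example : (List.range 8).map (bOfA ![1, 1, 1, 1, 1, 1, 1, 1]) = [3, 1, 1, 1, 1, 1, 1, 1] := by decide
example : dOf (bOfA ![1, 1, 1, 1, 1, 1, 1, 1]) = 2 := by decide
set_option maxRecDepth 8192 in
example : m1Of ![1, 1, 1, 1, 1, 1, 1, 1] = 1 := by decide
example : InRegion ((1 : ℕ) • ![1, 1, 1, 1, 1, 1, 1, 1]) 1 :=
  ⟨by decide, by decide, by decide, by decide, by decide⟩
example : (List.range 8).map (bOfA ((2 : ℕ) • ![1, 1, 1, 1, 1, 1, 1, 1])) = [6, 2, 2, 2, 2, 2, 2, 2] := by decide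
example : dOf (bOfA ((2 : ℕ) • ![1, 1, 1, 1, 1, 1, 1, 1])) = 4 := by decide
set_option maxRecDepth 16384 in
example : m1Of ((2 : ℕ) • ![1, 1, 1, 1, 1, 1, 1, 1]) = 2 := by decide
example : InRegion ((2 : ℕ) • ![1, 1, 1, 1, 1, 1, 1, 1]) 1 :=
  ⟨by decide, by decide, by decide, by decide, by decide⟩

-- Sanity: the v1/v2 witness of correction (A) instantiates the hypotheses: at the record `m₁ = 18 < 25 = D < 2·13`.
set_option maxRecDepth 16384 in
example : m1Of ![8, 16, 10, 15, 12, 16, 18, 13] = 18 := by decide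

/-- Sanity: `D(a) = d(b(a))` at the witness is `138 = 42 − 5 − 44 + 46 + 52 + 47`. -/
example : dOf (bOfA ![42, 5, 44, 4, 46, 50, 52, 47]) = 138 := by decide

/-- Sanity: at the BZ record `D = 25 ≤ 2·m₁ = 36` (regime where (28) is observed to hold). -/
example : dOf (bOfA ![8, 16, 10, 15, 12, 16, 18, 13]) = 25 := by decide

end Summit.KontsevichZagierPeriods.Zeta5Search.XSave
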